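import Summits.AtomisticToContinuum.FouriersLaw.Theorems.OddSectorIrreversibilityOddCorrectorDecayPointwiseForcing
import Summits.AtomisticToContinuum.FouriersLaw.Theorems.OddSectorIrreversibilityOddCorrectorDecayVariationPathBound

/-!
# Pointwise inequalities for the bath-locality estimate, III: the full pointwise bound

Support file for item `stmt-AtomisticToContinuum-9139` (`OddSectorIrreversibility.OddCorrectorDecay`), negative
side. Path by path (initial point `x`, Brownian pair `ω`), at a time `0 < t ≤ t₀` and for every parameter
`s > 0`, the squared difference of the total current between the Brownian-driven open chain
`z = Φ(x, B(ω))` and the closed chain `y = φ(x)` is bounded by a SUM of five kinds of terms: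
`(J(z_t) - J(y_t))² ≤ [s³·1216(Ψ(z_t)+Ψ(y_t)) + s³·t⁻¹∫₀ᵗ e^{6t₀(ω₂+4)}(Ψ(z_τ)+Ψ(y_τ))dτ
  + (a₁(|B¹_t|⁶+|B²_t|⁶) + a₂∫₀ᵗ(|B¹_u|⁶+|B²_u|⁶)du + a₃∫₀ᵗ(p_0(z_v)⁶+p_{N-1}(z_v)⁶)dv)/s⁶] / 3`
(`sq_currentDiff_le_pointwise`), where `Ψ = Ψ_κ` is the one-site sum of `PointwiseWeights` with
`κ ≥ 4+24β, 144β, 6t₀(3lam+48β)`. Ingredients: the pathwise product bound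
`ChainVariation.sq_totalCurrent_sub_le_path`, AM–GM with parameter `s` (`mul_mul_sq_le_of_pos`), the weight and
rate bounds of `PointwiseWeights` with Jensen in time for the Grönwall factor, and the forcing bound of
`PointwiseForcing`. Every term on the right has an `N`-uniform or single-site Gibbs expectation.
-/

noncomputable section

open MeasureTheory Set Finset intervalIntegral
open scoped NNReal
open Literature.Probability.Process
open Literature.MathematicalPhysics.KineticTheory Literature.MathematicalPhysics.KineticTheory.HeatConduction
open OscillatorChain (bathWeight)

namespace Summit.AtomisticToContinuum.FouriersLaw.Theorems.ChainVariation

variable {N : ℕ}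

section Pointwise

variable {ω₂ lam β γ : ℝ} (hω : 0 < ω₂) (hl : 0 ≤ lam) (hβ : 0 ≤ β) (hγ : 0 ≤ γ) (hN : 0 < N) (T : ℝ)
include hω hl hβ hγ hN

omit hN in
/-- Continuity in time of the one-site sum along the open and the closed chain. [folklore] -/
theorem continuous_oneSiteSum_chains (x : PhaseSpace N) (ω : WienerPair) (κ : ℝ) :
    Continuous (fun τ => (∑ i, (Real.exp (κ * (((pinnedChain ω₂ lam β γ).chainFlow N x (chainNoise N (Real.sqrt (2 * (pinnedChain ω₂ lam β γ).γ * T)) (Real.sqrt (2 * (pinnedChain ω₂ lam β γ).γ * T)) (pairPath ω)) τ).1 i) ^ 2) + (((pinnedChain ω₂ lam β γ).chainFlow N x (chainNoise N (Real.sqrt (2 * (pinnedChain ω₂ lam β γ).γ * T)) (Real.sqrt (2 * (pinnedChain ω₂ lam β γ).γ * T)) (pairPath ω)) τ).2 i) ^ 12 + 1)) +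
      (∑ i, (Real.exp (κ * (((pinnedChain ω₂ lam β 0).chainFlow N x 0 τ).1 i) ^ 2) + (((pinnedChain ω₂ lam β 0).chainFlow N x 0 τ).2 i) ^ 12 + 1))) := by
  have hzc : Continuous fun τ => ((pinnedChain ω₂ lam β γ).chainFlow N x (chainNoise N (Real.sqrt (2 * (pinnedChain ω₂ lam β γ).γ * T)) (Real.sqrt (2 * (pinnedChain ω₂ lam β γ).γ * T)) (pairPath ω)) τ) :=
    pinnedChain_continuous_chainFlow hω hl hβ hγ N x (continuous_chainNoise _ _ _)
  have h0 : Continuous (0 : ℝ → Fin N → ℝ) := continuous_const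
  have hyc : Continuous fun τ => ((pinnedChain ω₂ lam β 0).chainFlow N x 0 τ) :=
    pinnedChain_continuous_chainFlow hω hl hβ le_rfl N x h0
  have hΨ : Continuous fun v : PhaseSpace N => ∑ i, (Real.exp (κ * (v.1 i) ^ 2) + (v.2 i) ^ 12 + 1) := by
    fun_prop
  exact (hΨ.comp hzc).add (hΨ.comp hyc)

/-- **The full pointwise bound** (see the module docstring). [folklore] -/
theorem sq_currentDiff_le_pointwise (x : PhaseSpace N) (ω : WienerPair) {t t₀ s κ : ℝ} (ht : 0 < t)
    (htt : t ≤ t₀) (hs : 0 < s) (hκ₁ : 4 + 24 * β ≤ κ) (hκ₂ : 144 * β ≤ κ)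
    (hκ₃ : 6 * t₀ * (3 * lam + 48 * β) ≤ κ) :
    ((∑ i, (pinnedChain ω₂ lam β γ).bondCurrent N i ((pinnedChain ω₂ lam β γ).chainFlow N x (chainNoise N (Real.sqrt (2 * (pinnedChain ω₂ lam β γ).γ * T)) (Real.sqrt (2 * (pinnedChain ω₂ lam β γ).γ * T)) (pairPath ω)) t)) -
        (∑ i, (pinnedChain ω₂ lam β γ).bondCurrent N i ((pinnedChain ω₂ lam β 0).chainFlow N x 0 t))) ^ 2 ≤
      (s ^ 3 * (1216 * ((∑ i, (Real.exp (κ * (((pinnedChain ω₂ lam β γ).chainFlow N x (chainNoise N (Real.sqrt (2 * (pinnedChain ω₂ lam β γ).γ * T)) (Real.sqrt (2 * (pinnedChain ω₂ lam β γ).γ * T)) (pairPath ω)) t).1 i) ^ 2) + (((pinnedChain ω₂ lam β γ).chainFlow N x (chainNoise N (Real.sqrt (2 * (pinnedChain ω₂ lam β γ).γ * T)) (Real.sqrt (2 * (pinnedChain ω₂ lam β γ).γ * T)) (pairPath ω)) t).2 i) ^ 12 + 1)) +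
          (∑ i, (Real.exp (κ * (((pinnedChain ω₂ lam β 0).chainFlow N x 0 t).1 i) ^ 2) + (((pinnedChain ω₂ lam β 0).chainFlow N x 0 t).2 i) ^ 12 + 1)))) +
        s ^ 3 * (t⁻¹ * ∫ τ in (0:ℝ)..t, Real.exp (6 * t₀ * (ω₂ + 4)) *
          ((∑ i, (Real.exp (κ * (((pinnedChain ω₂ lam β γ).chainFlow N x (chainNoise N (Real.sqrt (2 * (pinnedChain ω₂ lam β γ).γ * T)) (Real.sqrt (2 * (pinnedChain ω₂ lam β γ).γ * T)) (pairPath ω)) τ).1 i) ^ 2) + (((pinnedChain ω₂ lam β γ).chainFlow N x (chainNoise N (Real.sqrt (2 * (pinnedChain ω₂ lam β γ).γ * T)) (Real.sqrt (2 * (pinnedChain ω₂ lam β γ).γ * T)) (pairPath ω)) τ).2 i) ^ 12 + 1)) +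
            (∑ i, (Real.exp (κ * (((pinnedChain ω₂ lam β 0).chainFlow N x 0 τ).1 i) ^ 2) + (((pinnedChain ω₂ lam β 0).chainFlow N x 0 τ).2 i) ^ 12 + 1)))) +
        (32768 * (Real.sqrt (2 * (pinnedChain ω₂ lam β γ).γ * T)) ^ 6 * (|brownian t.toNNReal ω.1| ^ 6 + |brownian t.toNNReal ω.2| ^ 6) +
          32768 * t₀ ^ 5 * (Real.sqrt (2 * (pinnedChain ω₂ lam β γ).γ * T)) ^ 6 *
            (∫ u in (0:ℝ)..t, (|brownian u.toNNReal ω.1| ^ 6 + |brownian u.toNNReal ω.2| ^ 6)) +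
          1048576 * γ ^ 6 * t₀ ^ 5 * (1 + t₀ ^ 6) *
            ∫ v in (0:ℝ)..t, (((pinnedChain ω₂ lam β γ).chainFlow N x (chainNoise N (Real.sqrt (2 * (pinnedChain ω₂ lam β γ).γ * T)) (Real.sqrt (2 * (pinnedChain ω₂ lam β γ).γ * T)) (pairPath ω)) v).2 ⟨0, hN⟩ ^ 6 +
              ((pinnedChain ω₂ lam β γ).chainFlow N x (chainNoise N (Real.sqrt (2 * (pinnedChain ω₂ lam β γ).γ * T)) (Real.sqrt (2 * (pinnedChain ω₂ lam β γ).γ * T)) (pairPath ω)) v).2 ⟨N - 1, by omega⟩ ^ 6)) / s ^ 6) / 3 := by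
  have hne : (Finset.univ : Finset (Fin N)).Nonempty := (Finset.univ_nonempty_iff.2 (Fin.pos_iff_nonempty.1 hN))
  have hη : Continuous (chainNoise N (Real.sqrt (2 * (pinnedChain ω₂ lam β γ).γ * T)) (Real.sqrt (2 * (pinnedChain ω₂ lam β γ).γ * T)) (pairPath ω)) := continuous_chainNoise _ _ _
  have h0 : Continuous (0 : ℝ → Fin N → ℝ) := continuous_const
  have hzc : Continuous fun τ => ((pinnedChain ω₂ lam β γ).chainFlow N x (chainNoise N (Real.sqrt (2 * (pinnedChain ω₂ lam β γ).γ * T)) (Real.sqrt (2 * (pinnedChain ω₂ lam β γ).γ * T)) (pairPath ω)) τ) :=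
    pinnedChain_continuous_chainFlow hω hl hβ hγ N x hη
  have hyc : Continuous fun τ => ((pinnedChain ω₂ lam β 0).chainFlow N x 0 τ) :=
    pinnedChain_continuous_chainFlow hω hl hβ le_rfl N x h0
  -- the pathwise product bound `(ΔJ)² ≤ (W G E)²`
  have hpath := sq_totalCurrent_sub_le_path hω hl hβ hγ hN x hη (t₀ := t₀) t ⟨ht.le, htt⟩
  -- name the three factors
  set W : ℝ := (Finset.univ.sup' (Finset.univ_nonempty_iff.2 (Fin.pos_iff_nonempty.1 hN))
      (fun i : Fin N => ∑ j : Fin N, if j.val = i.val + 1 then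
        |deriv (pinnedChain ω₂ lam β γ).V (((pinnedChain ω₂ lam β γ).chainFlow N x (chainNoise N (Real.sqrt (2 * (pinnedChain ω₂ lam β γ).γ * T)) (Real.sqrt (2 * (pinnedChain ω₂ lam β γ).γ * T)) (pairPath ω)) t).1 j - ((pinnedChain ω₂ lam β γ).chainFlow N x (chainNoise N (Real.sqrt (2 * (pinnedChain ω₂ lam β γ).γ * T)) (Real.sqrt (2 * (pinnedChain ω₂ lam β γ).γ * T)) (pairPath ω)) t).1 i)| else 0)) +
    2 * (Finset.univ.sup' (Finset.univ_nonempty_iff.2 (Fin.pos_iff_nonempty.1 hN)) (fun i : Fin N => |((pinnedChain ω₂ lam β 0).chainFlow N x 0 t).2 i|)) *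
      (1 + 12 * β * (Finset.univ.sup' (Finset.univ_nonempty_iff.2 (Fin.pos_iff_nonempty.1 hN))
        (fun i : Fin N => max (((pinnedChain ω₂ lam β γ).chainFlow N x (chainNoise N (Real.sqrt (2 * (pinnedChain ω₂ lam β γ).γ * T)) (Real.sqrt (2 * (pinnedChain ω₂ lam β γ).γ * T)) (pairPath ω)) t).1 i ^ 2) (((pinnedChain ω₂ lam β 0).chainFlow N x 0 t).1 i ^ 2)))) with hW
  set G : ℝ := (∑ i, |(chainNoise N (Real.sqrt (2 * (pinnedChain ω₂ lam β γ).γ * T)) (Real.sqrt (2 * (pinnedChain ω₂ lam β γ).γ * T)) (pairPath ω)) t i - γ * ∫ v in (0:ℝ)..t, bathWeight N i * ((pinnedChain ω₂ lam β γ).chainFlow N x (chainNoise N (Real.sqrt (2 * (pinnedChain ω₂ lam β γ).γ * T)) (Real.sqrt (2 * (pinnedChain ω₂ lam β γ).γ * T)) (pairPath ω)) v).2 i|) +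
    ∫ u in (0:ℝ)..t, ∑ i, |(chainNoise N (Real.sqrt (2 * (pinnedChain ω₂ lam β γ).γ * T)) (Real.sqrt (2 * (pinnedChain ω₂ lam β γ).γ * T)) (pairPath ω)) u i - γ * ∫ v in (0:ℝ)..u, bathWeight N i * ((pinnedChain ω₂ lam β γ).chainFlow N x (chainNoise N (Real.sqrt (2 * (pinnedChain ω₂ lam β γ).γ * T)) (Real.sqrt (2 * (pinnedChain ω₂ lam β γ).γ * T)) (pairPath ω)) v).2 i| with hG
  set A : ℝ → ℝ := fun τ => (ω₂ + 4) + (3 * lam + 48 * β) *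
    (Finset.univ.sup' (Finset.univ_nonempty_iff.2 (Fin.pos_iff_nonempty.1 hN)) (fun i : Fin N => max (((pinnedChain ω₂ lam β γ).chainFlow N x (chainNoise N (Real.sqrt (2 * (pinnedChain ω₂ lam β γ).γ * T)) (Real.sqrt (2 * (pinnedChain ω₂ lam β γ).γ * T)) (pairPath ω)) τ).1 i ^ 2) (((pinnedChain ω₂ lam β 0).chainFlow N x 0 τ).1 i ^ 2))) with hA
  set E : ℝ := Real.exp (∫ τ in (0:ℝ)..t, A τ) with hE
  set Ψ : PhaseSpace N → ℝ := fun v => ∑ i, (Real.exp (κ * (v.1 i) ^ 2) + (v.2 i) ^ 12 + 1) with hΨ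
  have hΨc : Continuous Ψ := by rw [hΨ]; fun_prop
  have hΨ0 : ∀ v, 0 ≤ Ψ v := fun v => Finset.sum_nonneg fun i _ => by positivity
  -- AM–GM with parameter
  have hamgm := mul_mul_sq_le_of_pos W G E hs
  -- the weight
  have hWb : W ^ 6 ≤ 1216 * (Ψ ((pinnedChain ω₂ lam β γ).chainFlow N x (chainNoise N (Real.sqrt (2 * (pinnedChain ω₂ lam β γ).γ * T)) (Real.sqrt (2 * (pinnedChain ω₂ lam β γ).γ * T)) (pairPath ω)) t) + Ψ ((pinnedChain ω₂ lam β 0).chainFlow N x 0 t)) :=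
    weight_pow_six_le_oneSiteSum hβ ω₂ lam γ hne hκ₁ hκ₂ _ _
  -- the Grönwall factor
  have hAc : Continuous A := by
    refine continuous_const.add (continuous_const.mul ?_)
    refine Continuous.finset_sup'_apply hne fun i _ => ?_
    exact ((((continuous_apply i).comp (continuous_fst.comp hzc)).pow 2).max
      (((continuous_apply i).comp (continuous_fst.comp hyc)).pow 2))
  have hEb : E ^ 6 ≤ t⁻¹ * ∫ τ in (0:ℝ)..t, Real.exp (6 * t₀ * (ω₂ + 4)) * (Ψ ((pinnedChain ω₂ lam β γ).chainFlow N x (chainNoise N (Real.sqrt (2 * (pinnedChain ω₂ lam β γ).γ * T)) (Real.sqrt (2 * (pinnedChain ω₂ lam β γ).γ * T)) (pairPath ω)) τ) + Ψ ((pinnedChain ω₂ lam β 0).chainFlow N x 0 τ)) := by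
    have h1 : E ^ 6 = Real.exp (∫ τ in (0:ℝ)..t, 6 * A τ) := by
      rw [hE, ← Real.exp_nat_mul, intervalIntegral.integral_const_mul]
      norm_num
    have h2 := exp_intervalIntegral_le (continuous_const.mul hAc : Continuous fun τ => 6 * A τ) ht
    have h3 : ∫ τ in (0:ℝ)..t, Real.exp (t * (6 * A τ)) ≤
        ∫ τ in (0:ℝ)..t, Real.exp (6 * t₀ * (ω₂ + 4)) * (Ψ ((pinnedChain ω₂ lam β γ).chainFlow N x (chainNoise N (Real.sqrt (2 * (pinnedChain ω₂ lam β γ).γ * T)) (Real.sqrt (2 * (pinnedChain ω₂ lam β γ).γ * T)) (pairPath ω)) τ) + Ψ ((pinnedChain ω₂ lam β 0).chainFlow N x 0 τ)) := by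
      refine intervalIntegral.integral_mono_on ht.le
        ((Real.continuous_exp.comp (continuous_const.mul (continuous_const.mul hAc))).intervalIntegrable _ _)
        ((continuous_const.mul ((hΨc.comp hzc).add (hΨc.comp hyc))).intervalIntegrable _ _) fun τ _ => ?_
      have e : t * (6 * A τ) = 6 * t * ((ω₂ + 4) + (3 * lam + 48 * β) *
          (Finset.univ.sup' hne (fun i : Fin N => max (((pinnedChain ω₂ lam β γ).chainFlow N x (chainNoise N (Real.sqrt (2 * (pinnedChain ω₂ lam β γ).γ * T)) (Real.sqrt (2 * (pinnedChain ω₂ lam β γ).γ * T)) (pairPath ω)) τ).1 i ^ 2) (((pinnedChain ω₂ lam β 0).chainFlow N x 0 τ).1 i ^ 2)))) := by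
        rw [hA]; ring
      rw [e]
      exact exp_mul_coeff_le_oneSiteSum hω.le hl hβ hne htt hκ₃ _ _
    rw [h1]
    exact h2.trans (mul_le_mul_of_nonneg_left h3 (inv_nonneg.2 ht.le))
  -- the forcing
  have hGb := forcingTotal_pow_six_le hω hl hβ hγ hN T x ω ht htt
  -- assemble
  have hs3 : 0 < s ^ 3 := pow_pos hs 3
  have hs6 : 0 < s ^ 6 := pow_pos hs 6
  have hG0 : 0 ≤ G ^ 6 := by positivity
  calc ((∑ i, (pinnedChain ω₂ lam β γ).bondCurrent N i ((pinnedChain ω₂ lam β γ).chainFlow N x (chainNoise N (Real.sqrt (2 * (pinnedChain ω₂ lam β γ).γ * T)) (Real.sqrt (2 * (pinnedChain ω₂ lam β γ).γ * T)) (pairPath ω)) t)) -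
        (∑ i, (pinnedChain ω₂ lam β γ).bondCurrent N i ((pinnedChain ω₂ lam β 0).chainFlow N x 0 t))) ^ 2
      ≤ (W * G * E) ^ 2 := hpath
    _ ≤ (s ^ 3 * W ^ 6 + s ^ 3 * E ^ 6 + G ^ 6 / s ^ 6) / 3 := hamgm
    _ ≤ _ := by
        refine div_le_div_of_nonneg_right (add_le_add (add_le_add ?_ ?_) ?_) (by norm_num)
        · exact mul_le_mul_of_nonneg_left hWb hs3.le
        · exact mul_le_mul_of_nonneg_left hEb hs3.le
        · exact div_le_div_of_nonneg_right hGb hs6.le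

end Pointwise

end Summit.AtomisticToContinuum.FouriersLaw.Theorems.ChainVariation

end
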